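import Mathlib
import HarnessLib
import Literature.Analysis.Complex.VerticalSinSummation
import Literature.NumberTheory.LFunctions.HorocycleRHMellinShift
import Literature.Analysis.SpecialFunctions.SechCosineTransform
import Summits.KontsevichZagierPeriods.Zeta5Search.Denom.KernelStripStep
import Summits.KontsevichZagierPeriods.Zeta5Search.Denom.KernelSechSq
import Summits.KontsevichZagierPeriods.Zeta5Search.Denom.KernelResidueStep

/-!
# The first-power Barnes kernel `π/sin πt`: profile `π/cosh(πy)` and the unit strip step

HONEST FRAMING: systematic search; no irrationality claim unless certified.  Cell pub-zeta5, class `measure`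
(fam-measure g5, file U2-1 of the tale-2 decay chain for `Denom.TwoTaleP15Coincidence.DecayT`; design value,
formalisation pending).  Pure complex analysis; no arithmetic and no claim about any zeta value is made here.

Zudilin's second hypergeometric tale ([Zudilin2014ZetaTwo] arXiv:1310.1526, §6, Prop. 3) integrates `R̂(t)`
against the FIRST-power kernel `π/sin 2πt` (`π/sin πu` in `u = 2t`), whose integer poles are SIMPLE; the first
tale's kernel files `Denom/Kernel{StripStep,ResidueStep,SechSq}` treat `(π/sin πt)²`.  This file is their
first-power twin: the profile `sech1 y = π/cosh(πy)` (`= ± π/sin π(x+iy)` on a half-integer line `x`,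
`kernel1_halfLine`; `∫ sech1 = π` from the tree's `integral_univ_cos_div_cosh`; `sech1·φ` integrable for
continuous `φ` of polynomial growth, `integrable_sech1_mul`), and **`integral_kernel1_step`**: for `g`
holomorphic on the closed strip `|Re t − m| ≤ ½` with `g(m) = 0` and `‖g t‖ ≤ A(1+(Im t)²)^N`, the
`π/sin πt`-weighted integrals over `Re t = m ∓ ½` agree (ONE `dslope` cancels the simple pole; the line is
moved by the tree's `integral_vertical_eq_of_norm_le_div`).  Profile form with the residue `2π g(m)`: U2-2.
-/
noncomputable section

open Complex Set MeasureTheory Filter Topology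
open Summit.KontsevichZagierPeriods.Zeta5Search.Denom.KernelStripStep
open Summit.KontsevichZagierPeriods.Zeta5Search.Denom.KernelResidueStep (line_mem_halfStrip)
open Summit.KontsevichZagierPeriods.Zeta5Search.Denom.KernelSechSq (cos_pi_mul_intCast_add_half
  cos_pi_mul_intCast_sub_half)

namespace Summit.KontsevichZagierPeriods.Zeta5Search.TwoTaleSechKernel

/-! ### The profile `π / cosh(πy)` -/

/-- The profile `sech1 y = π / cosh(πy)` of the first-power kernel on half-integer lines. -/
def sech1 (y : ℝ) : ℝ := Real.pi / Real.cosh (Real.pi * y)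

/-- `sech1 ≥ 0`. -/
theorem sech1_nonneg (y : ℝ) : 0 ≤ sech1 y := by
  unfold sech1
  exact div_nonneg Real.pi_pos.le (Real.cosh_pos _).le

/-- `sech1 ≤ π`. -/
theorem sech1_le_pi (y : ℝ) : sech1 y ≤ Real.pi := by
  unfold sech1
  exact div_le_self Real.pi_pos.le (Real.one_le_cosh _)

/-- `sech1` is continuous. -/
theorem continuous_sech1 : Continuous sech1 := by
  unfold sech1
  exact continuous_const.div (by fun_prop) fun y => (Real.cosh_pos _).ne'

/-- **`∫_ℝ π/cosh(πy) dy = π`** (the tree's cosine transform of `sech` at frequency `0`). -/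
theorem integral_sech1 : ∫ y : ℝ, sech1 y = Real.pi := by
  have h := Literature.Analysis.SpecialFunctions.integral_univ_cos_div_cosh Real.pi_pos 0
  simp only [zero_mul, Real.cos_zero, mul_zero, zero_div, Real.cosh_zero, div_one,
    div_self Real.pi_pos.ne'] at h
  have e : (fun y : ℝ => sech1 y) = fun y : ℝ => Real.pi * (1 / Real.cosh (Real.pi * y)) := by
    funext y
    unfold sech1
    ring
  rw [e, integral_const_mul, h, mul_one]

/-! ### The kernel on half-integer lines -/

/-- `sin (π(m + ½)) = cos (πm)`. -/
theorem sin_pi_mul_intCast_add_half (m : ℤ) :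
    Real.sin (Real.pi * ((m : ℝ) + 1 / 2)) = Real.cos (Real.pi * m) := by
  rw [show Real.pi * ((m : ℝ) + 1 / 2) = Real.pi * m + Real.pi / 2 by ring, Real.sin_add_pi_div_two]

/-- `sin (π(m − ½)) = −cos (πm)`. -/
theorem sin_pi_mul_intCast_sub_half (m : ℤ) :
    Real.sin (Real.pi * ((m : ℝ) - 1 / 2)) = -Real.cos (Real.pi * m) := by
  rw [show Real.pi * ((m : ℝ) - 1 / 2) = Real.pi * m - Real.pi / 2 by ring, Real.sin_sub_pi_div_two]

/-- `cos (πm) ≠ 0` at an integer `m` (indeed `cos² = 1 − sin² = 1`). -/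
theorem cos_pi_mul_intCast_ne_zero (m : ℤ) : Real.cos (Real.pi * m) ≠ 0 := by
  have hs : Real.sin (Real.pi * m) = 0 := by rw [mul_comm]; exact Real.sin_int_mul_pi m
  intro h
  nlinarith [Real.sin_sq_add_cos_sq (Real.pi * m)]

/-- **The kernel on a line through a zero of `cos πx`** (a half-integer abscissa):
`π / sin π(x + iy) = sin(πx) · π/cosh(πy)`, a real number (`sin πx = ±1`). -/
theorem kernel1_halfLine {x : ℝ} (hx : Real.cos (Real.pi * x) = 0) (y : ℝ) :
    (Real.pi : ℂ) / Complex.sin (Real.pi * ((x : ℂ) + (y : ℂ) * I)) = ((Real.sin (Real.pi * x) * sech1 y : ℝ) : ℂ) := by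
  have hsin2 : Real.sin (Real.pi * x) ^ 2 = 1 := by
    have := Real.sin_sq_add_cos_sq (Real.pi * x)
    rw [hx] at this
    linarith
  have hs : Complex.sin (Real.pi * ((x : ℂ) + (y : ℂ) * I)) =
      (Real.sin (Real.pi * x) : ℂ) * (Real.cosh (Real.pi * y) : ℂ) := by
    have harg : (Real.pi : ℂ) * ((x : ℂ) + (y : ℂ) * I) =
        ((Real.pi * x : ℝ) : ℂ) + ((Real.pi * y : ℝ) : ℂ) * I := by
      push_cast
      ring
    rw [harg, Complex.sin_add, Complex.sin_mul_I, Complex.cos_mul_I, ← Complex.ofReal_sin,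
      ← Complex.ofReal_cos, hx, Complex.ofReal_cosh]
    push_cast
    ring
  have hc : Real.cosh (Real.pi * y) ≠ 0 := (Real.cosh_pos _).ne'
  have hsx : Real.sin (Real.pi * x) ≠ 0 := by
    intro h
    rw [h] at hsin2
    norm_num at hsin2
  have key : Real.sin (Real.pi * x) * sech1 y = Real.pi / (Real.sin (Real.pi * x) * Real.cosh (Real.pi * y)) := by
    unfold sech1
    field_simp
    linear_combination hsin2
  rw [hs, key, Complex.ofReal_div, Complex.ofReal_mul]

/-- On `Re t = m + ½`: `π / sin πt = cos(πm) · sech1 y`. -/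
theorem kernel1_line_add_half (m : ℤ) (y : ℝ) :
    (Real.pi : ℂ) / Complex.sin (Real.pi * ((((m : ℝ) + 1 / 2 : ℝ) : ℂ) + (y : ℂ) * I)) =
      ((Real.cos (Real.pi * m) * sech1 y : ℝ) : ℂ) := by
  rw [kernel1_halfLine (cos_pi_mul_intCast_add_half m) y, sin_pi_mul_intCast_add_half]

/-- On `Re t = m − ½`: `π / sin πt = −cos(πm) · sech1 y`. -/
theorem kernel1_line_sub_half (m : ℤ) (y : ℝ) :
    (Real.pi : ℂ) / Complex.sin (Real.pi * ((((m : ℝ) - 1 / 2 : ℝ) : ℂ) + (y : ℂ) * I)) =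
      ((-Real.cos (Real.pi * m) * sech1 y : ℝ) : ℂ) := by
  rw [kernel1_halfLine (cos_pi_mul_intCast_sub_half m) y, sin_pi_mul_intCast_sub_half]

/-! ### Polynomial growth against `|sinh|`; integrability on a line -/

/-- The tail constant of `pow_le_abs_sinh`: the square root of the constant of `pow_le_sinh_sq (2N+1)`. -/
def tailConst (N : ℕ) : ℝ :=
  Real.sqrt ((2 : ℝ) ^ (2 * N + 1 + 1) / Real.pi ^ (2 * (2 * N + 1) + 2) * (Nat.factorial (2 * (2 * N + 1) + 2)) * 4)

/-- `tailConst N ≥ 0`. -/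
theorem tailConst_nonneg (N : ℕ) : 0 ≤ tailConst N := Real.sqrt_nonneg _

/-- For `|y| ≥ 1`: `(1 + y²)^{N+1} ≤ tailConst N · |sinh(πy)|` (square root of `pow_le_sinh_sq (2N+1)`). -/
theorem pow_le_abs_sinh (N : ℕ) {y : ℝ} (hy : 1 ≤ |y|) :
    (1 + y ^ 2) ^ (N + 1) ≤ tailConst N * |Real.sinh (Real.pi * y)| := by
  refine le_of_sq_le_sq ?_ (mul_nonneg (tailConst_nonneg N) (abs_nonneg _))
  rw [mul_pow, tailConst, Real.sq_sqrt (by positivity), sq_abs, ← pow_mul,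
    show (N + 1) * 2 = 2 * N + 1 + 1 by ring]
  exact pow_le_sinh_sq (2 * N + 1) hy

/-- `‖π / sin πt‖ ≤ π / |sinh(π·Im t)|` (when `Im t ≠ 0`). -/
theorem norm_piDivSin_le {t : ℂ} (ht : t.im ≠ 0) :
    ‖(Real.pi : ℂ) / Complex.sin (Real.pi * t)‖ ≤ Real.pi / |Real.sinh (Real.pi * t.im)| := by
  have hsh : 0 < |Real.sinh (Real.pi * t.im)| := by
    rw [abs_pos, Real.sinh_eq_zero.ne]
    exact mul_ne_zero Real.pi_ne_zero ht
  have hsin : |Real.sinh (Real.pi * t.im)| ≤ ‖Complex.sin (Real.pi * t)‖ := by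
    refine le_of_sq_le_sq ?_ (norm_nonneg _)
    rw [sq_abs, Literature.Analysis.Complex.norm_sin_sq_eq]
    have : ((Real.pi : ℂ) * t).im = Real.pi * t.im := by simp
    rw [this]
    nlinarith [sq_nonneg (Real.sin ((Real.pi : ℂ) * t).re)]
  rw [norm_div, Complex.norm_real, Real.norm_eq_abs, abs_of_pos Real.pi_pos]
  exact div_le_div_of_nonneg_left Real.pi_pos.le hsh hsin

/-- `sech1 y ≤ π / |sinh(πy)|` (`y ≠ 0`). -/
theorem sech1_le_div_abs_sinh {y : ℝ} (hy : y ≠ 0) : sech1 y ≤ Real.pi / |Real.sinh (Real.pi * y)| := by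
  have hsh : 0 < |Real.sinh (Real.pi * y)| := by
    rw [abs_pos, Real.sinh_eq_zero.ne]
    exact mul_ne_zero Real.pi_ne_zero hy
  unfold sech1
  refine div_le_div_of_nonneg_left Real.pi_pos.le hsh ?_
  exact le_of_sq_le_sq (by rw [sq_abs, Real.cosh_sq]; linarith) (Real.cosh_pos _).le

/-- The uniform weight bound `sech1(y)·(1+y²)^{N+1} ≤ π (tailConst N + 2^{N+1})`. -/
theorem sech1_mul_pow_le (N : ℕ) (y : ℝ) :
    sech1 y * (1 + y ^ 2) ^ (N + 1) ≤ Real.pi * (tailConst N + 2 ^ (N + 1)) := by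
  have hT := tailConst_nonneg N
  rcases le_or_gt 1 |y| with hy | hy
  · have hy0 : y ≠ 0 := fun h => by rw [h, abs_zero] at hy; linarith
    have hsh : 0 < |Real.sinh (Real.pi * y)| := by
      rw [abs_pos, Real.sinh_eq_zero.ne]; exact mul_ne_zero Real.pi_ne_zero hy0
    calc sech1 y * (1 + y ^ 2) ^ (N + 1)
        ≤ Real.pi / |Real.sinh (Real.pi * y)| * (tailConst N * |Real.sinh (Real.pi * y)|) :=
          mul_le_mul (sech1_le_div_abs_sinh hy0) (pow_le_abs_sinh N hy) (by positivity) (by positivity)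
      _ = Real.pi * tailConst N := by field_simp
      _ ≤ Real.pi * (tailConst N + 2 ^ (N + 1)) := by gcongr; linarith [pow_pos (two_pos (α := ℝ)) (N + 1)]
  · have hy2 : 1 + y ^ 2 ≤ 2 := by nlinarith [abs_nonneg y, sq_abs y]
    calc sech1 y * (1 + y ^ 2) ^ (N + 1) ≤ Real.pi * 2 ^ (N + 1) :=
          mul_le_mul (sech1_le_pi y) (pow_le_pow_left₀ (by positivity) hy2 _) (by positivity) Real.pi_pos.le
      _ ≤ Real.pi * (tailConst N + 2 ^ (N + 1)) := by gcongr; linarith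

/-- **`sech1 · φ` is integrable** when `φ` is continuous of polynomial growth. -/
theorem integrable_sech1_mul {φ : ℝ → ℂ} (hφ : Continuous φ) {A : ℝ} {N : ℕ}
    (hA : ∀ y : ℝ, ‖φ y‖ ≤ A * (1 + y ^ 2) ^ N) :
    Integrable fun y : ℝ => ((sech1 y : ℝ) : ℂ) * φ y := by
  have hA0 : 0 ≤ A := by
    have h := hA 0; norm_num at h; exact (norm_nonneg _).trans h
  refine (integrable_inv_one_add_sq.const_mul (A * (Real.pi * (tailConst N + 2 ^ (N + 1))))).mono'
    ((Complex.continuous_ofReal.comp continuous_sech1).mul hφ).aestronglyMeasurable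
    (Eventually.of_forall fun y => ?_)
  rw [norm_mul, Complex.norm_real, Real.norm_eq_abs, abs_of_nonneg (sech1_nonneg y)]
  have hq0 : (0 : ℝ) < 1 + y ^ 2 := by positivity
  calc sech1 y * ‖φ y‖ ≤ sech1 y * (A * (1 + y ^ 2) ^ N) := mul_le_mul_of_nonneg_left (hA y) (sech1_nonneg y)
    _ = A * (sech1 y * (1 + y ^ 2) ^ (N + 1)) * (1 + y ^ 2)⁻¹ := by field_simp; ring
    _ ≤ A * (Real.pi * (tailConst N + 2 ^ (N + 1))) * (1 + y ^ 2)⁻¹ :=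
        mul_le_mul_of_nonneg_right (mul_le_mul_of_nonneg_left (sech1_mul_pow_le N y) hA0) (inv_nonneg.2 hq0.le)

/-- `sech1` is integrable. -/
theorem integrable_sech1 : Integrable sech1 := by
  have h := integrable_sech1_mul (φ := fun _ : ℝ => (1 : ℂ)) continuous_const (A := 1) (N := 0)
    (fun y => by simp)
  simp only [mul_one] at h
  exact h.norm.mono' continuous_sech1.aestronglyMeasurable
    (Eventually.of_forall fun y => by rw [Complex.norm_real])

/-! ### The unit strip step across a simple pole of the kernel -/

/-- **The unit strip step across a simple zero (kernel form).**  `g` holomorphic on the closed strip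
`|Re t − m| ≤ ½`, `g(m) = 0`, `‖g(t)‖ ≤ A(1 + (Im t)²)^N` there ⟹ the `π/sin πt`-weighted line integrals over
`Re t = m ∓ ½` agree. -/
theorem integral_kernel1_step {g : ℂ → ℂ} {m : ℤ} {A : ℝ} {N : ℕ}
    (hg : DifferentiableOn ℂ g (halfStrip m)) (h0 : g m = 0)
    (hA : ∀ t ∈ halfStrip m, ‖g t‖ ≤ A * (1 + t.im ^ 2) ^ N) :
    ∫ y : ℝ, (Real.pi : ℂ) / Complex.sin (Real.pi * ((((m : ℝ) - 1 / 2 : ℝ) : ℂ) + (y : ℂ) * I)) *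
        g ((((m : ℝ) - 1 / 2 : ℝ) : ℂ) + (y : ℂ) * I) =
      ∫ y : ℝ, (Real.pi : ℂ) / Complex.sin (Real.pi * ((((m : ℝ) + 1 / 2 : ℝ) : ℂ) + (y : ℂ) * I)) *
        g ((((m : ℝ) + 1 / 2 : ℝ) : ℂ) + (y : ℂ) * I) := by
  -- the desingularised integrand `F = π/dsin · Q`, `(t − m) Q = g`
  set Q : ℂ → ℂ := dslope g m with hQdef
  have hQ : DifferentiableOn ℂ Q (halfStrip m) := (Complex.differentiableOn_dslope (halfStrip_mem_nhds m)).2 hg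
  have hQg : ∀ t, (t - m) * Q t = g t := fun t => by
    have := sub_smul_dslope g (m : ℂ) t; rwa [smul_eq_mul, h0, sub_zero] at this
  set F : ℂ → ℂ := fun t => (Real.pi : ℂ) / dsin m t * Q t with hFdef
  have hF : DifferentiableOn ℂ F (halfStrip m) :=
    DifferentiableOn.mul (DifferentiableOn.div (differentiableOn_const _)
      (differentiable_dsin m).differentiableOn fun t ht => dsin_ne_zero ht) hQ
  have hFeq : ∀ t ∈ halfStrip m, t ≠ m → F t = (Real.pi : ℂ) / Complex.sin (Real.pi * t) * g t := by
    intro t ht htm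
    have hs := sin_ne_zero_of_mem_halfStrip ht htm
    have htm' : t - m ≠ 0 := sub_ne_zero.2 htm
    simp only [hFdef]; rw [dsin_of_ne htm, ← hQg t]; field_simp
  have hmem : ∀ x y : ℝ, x ∈ Icc ((m : ℝ) - 1 / 2) ((m : ℝ) + 1 / 2) → ((x : ℂ) + (y : ℂ) * I) ∈ halfStrip m :=
    fun x y hx => line_mem_halfStrip hx y
  -- (i) compact part `|y| ≤ 1`
  set K : Set ℂ := halfStrip m ∩ im ⁻¹' Icc (-1) 1 with hKdef
  have hKc : IsCompact K := IsCompact.reProdIm isCompact_Icc isCompact_Icc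
  obtain ⟨B, hB⟩ := hKc.exists_bound_of_continuousOn (hF.continuousOn.mono inter_subset_left)
  -- (ii) the tail `|y| ≥ 1`
  have hA0 : 0 ≤ A := by
    have h := hA (m : ℂ) (mem_of_mem_nhds (halfStrip_mem_nhds m))
    norm_num at h
    exact (norm_nonneg _).trans h
  set C : ℝ := max (2 * B) (Real.pi * A * tailConst N) with hC
  have hbound : ∀ x y : ℝ, x ∈ Icc ((m : ℝ) - 1 / 2) ((m : ℝ) + 1 / 2) →
      ‖F ((x : ℂ) + (y : ℂ) * I)‖ ≤ C / (1 + y ^ 2) := by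
    intro x y hx
    have ht := hmem x y hx
    have hy0 : (0 : ℝ) < 1 + y ^ 2 := by positivity
    rw [le_div_iff₀ hy0]
    rcases le_or_gt |y| 1 with hy | hy
    · have hK : ((x : ℂ) + (y : ℂ) * I) ∈ K := ⟨ht, by simpa [hKdef, abs_le] using hy⟩
      have h := hB _ hK
      have hy2 : y ^ 2 ≤ 1 := by rw [← sq_abs]; nlinarith [abs_nonneg y]
      calc ‖F ((x : ℂ) + (y : ℂ) * I)‖ * (1 + y ^ 2) ≤ B * 2 :=
            mul_le_mul h (by linarith) hy0.le ((norm_nonneg _).trans h)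
        _ ≤ C := by rw [hC, mul_comm]; exact le_max_left _ _
    · have hyne : y ≠ 0 := by intro h; rw [h, abs_zero] at hy; linarith
      have htm : ((x : ℂ) + (y : ℂ) * I) ≠ m := by
        intro h; have := congrArg im h; simp at this; exact hyne this
      rw [hFeq _ ht htm, norm_mul]
      have him : ((x : ℂ) + (y : ℂ) * I).im = y := by simp
      have hk := norm_piDivSin_le (t := (x : ℂ) + (y : ℂ) * I) (by rw [him]; exact hyne)
      rw [him] at hk
      have hg' := hA _ ht
      rw [him] at hg'
      have hsh : 0 < |Real.sinh (Real.pi * y)| := by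
        rw [abs_pos, Real.sinh_eq_zero.ne]; exact mul_ne_zero Real.pi_ne_zero hyne
      have hpoly := pow_le_abs_sinh N hy.le
      calc ‖(Real.pi : ℂ) / Complex.sin (Real.pi * ((x : ℂ) + (y : ℂ) * I))‖ *
            ‖g ((x : ℂ) + (y : ℂ) * I)‖ * (1 + y ^ 2)
          ≤ Real.pi / |Real.sinh (Real.pi * y)| * (A * (1 + y ^ 2) ^ N) * (1 + y ^ 2) := by gcongr
        _ = Real.pi * A * ((1 + y ^ 2) ^ (N + 1) / |Real.sinh (Real.pi * y)|) := by rw [pow_succ]; ring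
        _ ≤ Real.pi * A * tailConst N := by
            gcongr
            rw [div_le_iff₀ hsh]; exact hpoly
        _ ≤ C := le_max_right _ _
  -- (iii) shift the line
  have hshift := Literature.NumberTheory.LFunctions.integral_vertical_eq_of_norm_le_div
    (σ₁ := (m : ℝ) - 1 / 2) (σ₂ := (m : ℝ) + 1 / 2) (by linarith) hF hbound
  have hl : ((m : ℝ) - 1 / 2) ∈ Icc ((m : ℝ) - 1 / 2) ((m : ℝ) + 1 / 2) := ⟨le_rfl, by linarith⟩
  have hr : ((m : ℝ) + 1 / 2) ∈ Icc ((m : ℝ) - 1 / 2) ((m : ℝ) + 1 / 2) := ⟨by linarith, le_rfl⟩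
  have hne : ∀ (s y : ℝ), s ≠ m → ((s : ℂ) + (y : ℂ) * I) ≠ (m : ℂ) := fun s y hs h => by
    have := congrArg re h; simp at this; exact hs this
  rw [← integral_congr_ae (Filter.Eventually.of_forall fun y =>
      hFeq _ (hmem _ y hl) (hne _ y (by linarith))),
    ← integral_congr_ae (Filter.Eventually.of_forall fun y =>
      hFeq _ (hmem _ y hr) (hne _ y (by linarith)))]
  exact hshift

end Summit.KontsevichZagierPeriods.Zeta5Search.TwoTaleSechKernel

end
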